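import Mathlib
import HarnessLib
import Summits.ValiantsHypothesis.ValiantsHypothesis.Theorems.LacunarySymmetroidMatrixDescartesOsculationLawCuspNonMonic
import Summits.ValiantsHypothesis.ValiantsHypothesis.Theorems.LacunarySymmetroidMatrixDescartesOsculationLawRankTwoColumnDet
import Summits.ValiantsHypothesis.ValiantsHypothesis.Theorems.LacunarySymmetroidMatrixDescartesFoldLawTwoKCurve
import Summits.ValiantsHypothesis.ValiantsHypothesis.Theorems.LacunarySymmetroidMatrixDescartesOsculationCensusRankOneLower

/-!
# ValiantsHypothesis / LacunarySymmetroid — crux `MatrixDescartes` (stmt-ValiantsHypothesis-18050, V1),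
# line «osculation-law» (`Cruxes/MatrixDescartes/Lines/osculation_law.lean`), rung O3 «extremal-support families from the census»:
# the RANK-TWO certificate at EVERY splitting `(2, s)` — finiteness + count from three exact checks, and the LOWER side from sign windows

Roster R2664 (b) / R2685 (O3 = val-sym-engine-7; this file engine-7 g4).  Companion of ✓ `…OsculationCensusRankOneCert` /
✓ `…RankOneLower` (splittings `(1, s)`) and ✓ `…RankTwoCert` / ✓ `…RankTwoLower` (the TOP splitting `(2, 0)` only).  The O3 table
(OSC-TABLE-g3 on 18050) has located-exact counts at the rank-two splittings with `s ≥ 1` — F4 `(2,1)` 1/1/4, F6 `(2,1)` 2/4/2, F5 `(2,2)`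
2/0/2/2/4/3 — with no kernel counterpart so far; this file is the reusable engine for them.

CONTENT (every `s`, every `K`; the line's `osculationSet d S` with `blockProj`, `insertionPoly`, `euler`, `logHessian` UNFOLDED verbatim).
For a block pencil `G(t) = Σ_l t^{d_l} S_l` on `Fin 2 ⊕ Fin s` the insertion polynomial is the NON-MONIC QUADRATIC LETTER
`Φ(t,b) = a(t) b² + m(t) b + δ(t)` with `a = det G₂₂`, `m` = the two diagonal cofactors, `δ = det G` (✓ `OsculationRankTwo.insertionPoly_two`);
on the curve `a⁴·H = U(t)·b + V(t)` with the tree's weight-12/13 polynomials `U, V` of `a, m, δ` (✓ `OsculationCuspGen.hess_reduce_poly`), hence at an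
osculation point `U(t) b + V(t) = 0` and `N(t) = 0`, `N = a V² − m U V + δ U²` (✓ `osc_abscissa`, ✓ `resultant_step`).
* `osc_rankTwo_finite_card_le` (UPPER): if `N ≢ 0`, `U ≢ 0` and `a, m, δ` have no common positive zero (no vertical ray), the osculation set is
  FINITE with `ncard ≤ 2·(N_N + N_U)` for any degree bounds `deg N ≤ N_N`, `deg U ≤ N_U`: its abscissae are roots of `N` (where `U(t) ≠ 0`) or of
  `U` (where `U(t) = 0`), and every fibre is the root set of the nonzero quadratic `a(t)X² + m(t)X + δ(t)`.
* `osc_rankTwo_card_ge` (LOWER): `k` pairwise separated windows `[l, u] ⊂ (0, ∞)` with `N(l)·N(u) ≤ 0` and `U·V < 0`, `a ≠ 0` on `[l, u]` exhibit `k`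
  distinct osculation points `(t, −V(t)/U(t))` (intermediate value theorem for `N`; `Φ(t, −V/U) = N/U² = 0`; `H = 0` by the reduction and `a(t) ≠ 0`),
  so `k ≤ ncard` (given finiteness).
Instances (closed forms of `a, m, δ`, the three checks, dyadic windows) are filed separately.

HONEST FRAMING.  Calibration tooling for a line stub (`m = 3, 4` are covered by `rungThree` / `rungFour` / `rungAll`); the LAW `stub_osculationLaw`,
the crux `MatrixDescartes`, Conjecture B and `VP ≠ VNP` are OPEN / NOT proved; no summit statement is proved by this file.  No definitions, no named
facts; Mathlib + the tree files `…OsculationLawCuspNonMonic` (`eval_logHessian_Psi`, `hess_reduce_poly`, `osc_abscissa`, `resultant_step`),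
`…OsculationLawRankTwoColumnDet` (`insertionPoly_two`), `…FoldLawTwoKCurve` (`FoldCurve.eval_Psi`), `…OsculationCensusRankOneLower`
(`exists_root_of_mul_nonpos`).
-/

-- `Summit.ValiantsHypothesis.ValiantsHypothesis.…` is the tree's mandated single-conjunct layout (Sub = Summit).
set_option linter.dupNamespace false

noncomputable section

namespace Summit.ValiantsHypothesis.ValiantsHypothesis.Theorems.LacunarySymmetroidMatrixDescartes

open Polynomial Matrix Finset
open scoped BigOperators

namespace OsculationCensus

/-- A real quadratic `A X² + M X + D` whose coefficients are not all zero is not the zero polynomial. [folklore] -/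
theorem quadratic_ne_zero {A M D : ℝ} (h : ¬ (A = 0 ∧ M = 0 ∧ D = 0)) : (C A * X ^ 2 + C M * X + C D : ℝ[X]) ≠ 0 := by
  intro h0
  apply h
  have h2 := congr_arg (fun q : ℝ[X] => q.coeff 2) h0
  have h1 := congr_arg (fun q : ℝ[X] => q.coeff 1) h0
  have hc := congr_arg (fun q : ℝ[X] => q.coeff 0) h0
  simp only [coeff_add, coeff_C_mul, coeff_X_pow, coeff_X, coeff_C, coeff_zero] at h2 h1 hc
  norm_num at h2 h1 hc
  exact ⟨h2, h1, hc⟩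

-- the statement carries `U`, `V` (35 products of polynomials) twice and the osculation set three times.
set_option maxHeartbeats 1600000 in
/-- **Rank-two osculation certificate, every splitting `(2, s)` (UPPER side).**  For a block pencil on `Fin 2 ⊕ Fin s` with
`a = det G₂₂`, `m` = the two diagonal cofactors, `δ = det G` and the tree's reduction pair `U, V` (`a⁴·H = U b + V` on the curve),
`N = a V² − m U V + δ U²`: if `N ≢ 0`, `U ≢ 0` and `a, m, δ` have no common positive zero, the osculation set (line vocabulary unfolded
verbatim) is finite with at most `2·(N_N + N_U)` points for any degree bounds `deg N ≤ N_N`, `deg U ≤ N_U`. [folklore] -/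
theorem osc_rankTwo_finite_card_le {s K : ℕ} (d : Fin K → ℕ) (S : Fin K → Matrix (Fin 2 ⊕ Fin s) (Fin 2 ⊕ Fin s) ℝ)
    (a m δ Up Vp : ℝ[X])
    (hA : (∑ l, (X : ℝ[X]) ^ d l • ((S l).toBlocks₂₂).map Polynomial.C).det = a)
    (hM : ((∑ l, (X : ℝ[X]) ^ d l • (S l).map Polynomial.C).updateRow (Sum.inl 0) (Pi.single (Sum.inl 0) 1 : Fin 2 ⊕ Fin s → ℝ[X])).det
        + ((∑ l, (X : ℝ[X]) ^ d l • (S l).map Polynomial.C).updateRow (Sum.inl 1) (Pi.single (Sum.inl 1) 1 : Fin 2 ⊕ Fin s → ℝ[X])).det = m)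
    (hD : (∑ l, (X : ℝ[X]) ^ d l • (S l).map Polynomial.C).det = δ)
    (hUp : Up = (4 : ℝ[X]) * a ^ 4 * m * δ * (X * derivative (X * derivative δ)) - (3 : ℝ[X]) * a ^ 4 * m * (X * derivative δ) ^ 2 + (4 : ℝ[X]) * a ^ 4 * δ ^ 2 * (X * derivative (X * derivative m)) - (4 : ℝ[X]) * a ^ 4 * δ * (X * derivative m) * (X * derivative δ) - a ^ 3 * m ^ 3 * (X * derivative (X * derivative δ)) - (5 : ℝ[X]) * a ^ 3 * m ^ 2 * δ * (X * derivative (X * derivative m)) + (4 : ℝ[X]) * a ^ 3 * m ^ 2 * (X * derivative m) * (X * derivative δ) - (8 : ℝ[X]) * a ^ 3 * m * δ ^ 2 * (X * derivative (X * derivative a)) + (2 : ℝ[X]) * a ^ 3 * m * δ * (X * derivative a) * (X * derivative δ) + a ^ 3 * m * δ * (X * derivative m) ^ 2 - (4 : ℝ[X]) * a ^ 3 * δ ^ 2 * (X * derivative a) * (X * derivative m) + a ^ 2 * m ^ 4 * (X * derivative (X * derivative m)) + (6 : ℝ[X]) * a ^ 2 * m ^ 3 * δ * (X * derivative (X * derivative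 a)) - (2 : ℝ[X]) * a ^ 2 * m ^ 3 * (X * derivative a) * (X * derivative δ) - a ^ 2 * m ^ 3 * (X * derivative m) ^ 2 + (4 : ℝ[X]) * a ^ 2 * m ^ 2 * δ * (X * derivative a) * (X * derivative m) + (9 : ℝ[X]) * a ^ 2 * m * δ ^ 2 * (X * derivative a) ^ 2 - a * m ^ 5 * (X * derivative (X * derivative a)) - (7 : ℝ[X]) * a * m ^ 3 * δ * (X * derivative a) ^ 2 + m ^ 5 * (X * derivative a) ^ 2)
    (hVp : Vp = (4 : ℝ[X]) * a ^ 4 * δ ^ 2 * (X * derivative (X * derivative δ)) - (4 : ℝ[X]) * a ^ 4 * δ * (X * derivative δ) ^ 2 - a ^ 3 * m ^ 2 * δ * (X * derivative (X * derivative δ)) - (4 : ℝ[X]) * a ^ 3 * m * δ ^ 2 * (X * derivative (X * derivative m)) + (4 : ℝ[X]) * a ^ 3 * m * δ * (X * derivative m) * (X * derivative δ) - (4 : ℝ[X]) * a ^ 3 * δ ^ 3 * (X * derivative (X * derivative a)) + a ^ 2 * m ^ 3 * δ * (X * derivative (X * derivative m)) + (5 : ℝ[X]) * a ^ 2 * m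 ^ 2 * δ ^ 2 * (X * derivative (X * derivative a)) - (2 : ℝ[X]) * a ^ 2 * m ^ 2 * δ * (X * derivative a) * (X * derivative δ) - a ^ 2 * m ^ 2 * δ * (X * derivative m) ^ 2 + (4 : ℝ[X]) * a ^ 2 * m * δ ^ 2 * (X * derivative a) * (X * derivative m) + (4 : ℝ[X]) * a ^ 2 * δ ^ 3 * (X * derivative a) ^ 2 - a * m ^ 4 * δ * (X * derivative (X * derivative a)) - (6 : ℝ[X]) * a * m ^ 2 * δ ^ 2 * (X * derivative a) ^ 2 + m ^ 4 * δ * (X * derivative a) ^ 2)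
    (hN : (a * Vp ^ 2 - m * Up * Vp + δ * Up ^ 2) ≠ 0) (hU0 : Up ≠ 0)
    (hray : ∀ t : ℝ, 0 < t → a.eval t = 0 → m.eval t = 0 → δ.eval t ≠ 0)
    (NN NU : ℕ) (hNN : (a * Vp ^ 2 - m * Up * Vp + δ * Up ^ 2).natDegree ≤ NN) (hNU : Up.natDegree ≤ NU) :
    {p : Fin 2 → ℝ | 0 < p 0 ∧ 0 < p 1 ∧ MvPolynomial.eval p (∑ l, (MvPolynomial.X (0 : Fin 2) : MvPolynomial (Fin 2) ℝ) ^ d l • (S l).map (MvPolynomial.C : ℝ →+* MvPolynomial (Fin 2) ℝ) +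
      (MvPolynomial.X (1 : Fin 2) : MvPolynomial (Fin 2) ℝ) • (Matrix.fromBlocks 1 0 0 0 : Matrix (Fin 2 ⊕ Fin s) (Fin 2 ⊕ Fin s) ℝ).map (MvPolynomial.C : ℝ →+* MvPolynomial (Fin 2) ℝ)).det = 0 ∧
      MvPolynomial.eval p (MvPolynomial.X 0 * MvPolynomial.pderiv 0 (MvPolynomial.X 0 * MvPolynomial.pderiv 0 (∑ l, (MvPolynomial.X (0 : Fin 2) : MvPolynomial (Fin 2) ℝ) ^ d l • (S l).map
      (MvPolynomial.C : ℝ →+* MvPolynomial (Fin 2) ℝ) + (MvPolynomial.X (1 : Fin 2) : MvPolynomial (Fin 2) ℝ) • (Matrix.fromBlocks 1 0 0 0 : Matrix (Fin 2 ⊕ Fin s) (Fin 2 ⊕ Fin s) ℝ).map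
      (MvPolynomial.C : ℝ →+* MvPolynomial (Fin 2) ℝ)).det) * (MvPolynomial.X 1 * MvPolynomial.pderiv 1 (∑ l, (MvPolynomial.X (0 : Fin 2) : MvPolynomial (Fin 2) ℝ) ^ d l • (S l).map
      (MvPolynomial.C : ℝ →+* MvPolynomial (Fin 2) ℝ) + (MvPolynomial.X (1 : Fin 2) : MvPolynomial (Fin 2) ℝ) • (Matrix.fromBlocks 1 0 0 0 : Matrix (Fin 2 ⊕ Fin s) (Fin 2 ⊕ Fin s) ℝ).map
      (MvPolynomial.C : ℝ →+* MvPolynomial (Fin 2) ℝ)).det) ^ 2 - 2 * (MvPolynomial.X 0 * MvPolynomial.pderiv 0 (MvPolynomial.X 1 * MvPolynomial.pderiv 1 (∑ l, (MvPolynomial.X (0 : Fin 2) :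
      MvPolynomial (Fin 2) ℝ) ^ d l • (S l).map (MvPolynomial.C : ℝ →+* MvPolynomial (Fin 2) ℝ) + (MvPolynomial.X (1 : Fin 2) : MvPolynomial (Fin 2) ℝ) • (Matrix.fromBlocks 1 0 0 0 : Matrix (Fin 2
      ⊕ Fin s) (Fin 2 ⊕ Fin s) ℝ).map (MvPolynomial.C : ℝ →+* MvPolynomial (Fin 2) ℝ)).det)) * (MvPolynomial.X 0 * MvPolynomial.pderiv 0 (∑ l, (MvPolynomial.X (0 : Fin 2) : MvPolynomial (Fin 2) ℝ)
      ^ d l • (S l).map (MvPolynomial.C : ℝ →+* MvPolynomial (Fin 2) ℝ) + (MvPolynomial.X (1 : Fin 2) : MvPolynomial (Fin 2) ℝ) • (Matrix.fromBlocks 1 0 0 0 : Matrix (Fin 2 ⊕ Fin s) (Fin 2 ⊕ Fin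
      s) ℝ).map (MvPolynomial.C : ℝ →+* MvPolynomial (Fin 2) ℝ)).det) * (MvPolynomial.X 1 * MvPolynomial.pderiv 1 (∑ l, (MvPolynomial.X (0 : Fin 2) : MvPolynomial (Fin 2) ℝ) ^ d l • (S l).map
      (MvPolynomial.C : ℝ →+* MvPolynomial (Fin 2) ℝ) + (MvPolynomial.X (1 : Fin 2) : MvPolynomial (Fin 2) ℝ) • (Matrix.fromBlocks 1 0 0 0 : Matrix (Fin 2 ⊕ Fin s) (Fin 2 ⊕ Fin s) ℝ).map
      (MvPolynomial.C : ℝ →+* MvPolynomial (Fin 2) ℝ)).det) + MvPolynomial.X 1 * MvPolynomial.pderiv 1 (MvPolynomial.X 1 * MvPolynomial.pderiv 1 (∑ l, (MvPolynomial.X (0 : Fin 2) : MvPolynomial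
      (Fin 2) ℝ) ^ d l • (S l).map (MvPolynomial.C : ℝ →+* MvPolynomial (Fin 2) ℝ) + (MvPolynomial.X (1 : Fin 2) : MvPolynomial (Fin 2) ℝ) • (Matrix.fromBlocks 1 0 0 0 : Matrix (Fin 2 ⊕ Fin s)
      (Fin 2 ⊕ Fin s) ℝ).map (MvPolynomial.C : ℝ →+* MvPolynomial (Fin 2) ℝ)).det) * (MvPolynomial.X 0 * MvPolynomial.pderiv 0 (∑ l, (MvPolynomial.X (0 : Fin 2) : MvPolynomial (Fin 2) ℝ) ^ d l •
      (S l).map (MvPolynomial.C : ℝ →+* MvPolynomial (Fin 2) ℝ) + (MvPolynomial.X (1 : Fin 2) : MvPolynomial (Fin 2) ℝ) • (Matrix.fromBlocks 1 0 0 0 : Matrix (Fin 2 ⊕ Fin s) (Fin 2 ⊕ Fin s) ℝ).map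
      (MvPolynomial.C : ℝ →+* MvPolynomial (Fin 2) ℝ)).det) ^ 2) = 0}.Finite ∧
    {p : Fin 2 → ℝ | 0 < p 0 ∧ 0 < p 1 ∧ MvPolynomial.eval p (∑ l, (MvPolynomial.X (0 : Fin 2) : MvPolynomial (Fin 2) ℝ) ^ d l • (S l).map (MvPolynomial.C : ℝ →+* MvPolynomial (Fin 2) ℝ) +
      (MvPolynomial.X (1 : Fin 2) : MvPolynomial (Fin 2) ℝ) • (Matrix.fromBlocks 1 0 0 0 : Matrix (Fin 2 ⊕ Fin s) (Fin 2 ⊕ Fin s) ℝ).map (MvPolynomial.C : ℝ →+* MvPolynomial (Fin 2) ℝ)).det = 0 ∧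
      MvPolynomial.eval p (MvPolynomial.X 0 * MvPolynomial.pderiv 0 (MvPolynomial.X 0 * MvPolynomial.pderiv 0 (∑ l, (MvPolynomial.X (0 : Fin 2) : MvPolynomial (Fin 2) ℝ) ^ d l • (S l).map
      (MvPolynomial.C : ℝ →+* MvPolynomial (Fin 2) ℝ) + (MvPolynomial.X (1 : Fin 2) : MvPolynomial (Fin 2) ℝ) • (Matrix.fromBlocks 1 0 0 0 : Matrix (Fin 2 ⊕ Fin s) (Fin 2 ⊕ Fin s) ℝ).map
      (MvPolynomial.C : ℝ →+* MvPolynomial (Fin 2) ℝ)).det) * (MvPolynomial.X 1 * MvPolynomial.pderiv 1 (∑ l, (MvPolynomial.X (0 : Fin 2) : MvPolynomial (Fin 2) ℝ) ^ d l • (S l).map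
      (MvPolynomial.C : ℝ →+* MvPolynomial (Fin 2) ℝ) + (MvPolynomial.X (1 : Fin 2) : MvPolynomial (Fin 2) ℝ) • (Matrix.fromBlocks 1 0 0 0 : Matrix (Fin 2 ⊕ Fin s) (Fin 2 ⊕ Fin s) ℝ).map
      (MvPolynomial.C : ℝ →+* MvPolynomial (Fin 2) ℝ)).det) ^ 2 - 2 * (MvPolynomial.X 0 * MvPolynomial.pderiv 0 (MvPolynomial.X 1 * MvPolynomial.pderiv 1 (∑ l, (MvPolynomial.X (0 : Fin 2) :
      MvPolynomial (Fin 2) ℝ) ^ d l • (S l).map (MvPolynomial.C : ℝ →+* MvPolynomial (Fin 2) ℝ) + (MvPolynomial.X (1 : Fin 2) : MvPolynomial (Fin 2) ℝ) • (Matrix.fromBlocks 1 0 0 0 : Matrix (Fin 2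
      ⊕ Fin s) (Fin 2 ⊕ Fin s) ℝ).map (MvPolynomial.C : ℝ →+* MvPolynomial (Fin 2) ℝ)).det)) * (MvPolynomial.X 0 * MvPolynomial.pderiv 0 (∑ l, (MvPolynomial.X (0 : Fin 2) : MvPolynomial (Fin 2) ℝ)
      ^ d l • (S l).map (MvPolynomial.C : ℝ →+* MvPolynomial (Fin 2) ℝ) + (MvPolynomial.X (1 : Fin 2) : MvPolynomial (Fin 2) ℝ) • (Matrix.fromBlocks 1 0 0 0 : Matrix (Fin 2 ⊕ Fin s) (Fin 2 ⊕ Fin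
      s) ℝ).map (MvPolynomial.C : ℝ →+* MvPolynomial (Fin 2) ℝ)).det) * (MvPolynomial.X 1 * MvPolynomial.pderiv 1 (∑ l, (MvPolynomial.X (0 : Fin 2) : MvPolynomial (Fin 2) ℝ) ^ d l • (S l).map
      (MvPolynomial.C : ℝ →+* MvPolynomial (Fin 2) ℝ) + (MvPolynomial.X (1 : Fin 2) : MvPolynomial (Fin 2) ℝ) • (Matrix.fromBlocks 1 0 0 0 : Matrix (Fin 2 ⊕ Fin s) (Fin 2 ⊕ Fin s) ℝ).map
      (MvPolynomial.C : ℝ →+* MvPolynomial (Fin 2) ℝ)).det) + MvPolynomial.X 1 * MvPolynomial.pderiv 1 (MvPolynomial.X 1 * MvPolynomial.pderiv 1 (∑ l, (MvPolynomial.X (0 : Fin 2) : MvPolynomial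
      (Fin 2) ℝ) ^ d l • (S l).map (MvPolynomial.C : ℝ →+* MvPolynomial (Fin 2) ℝ) + (MvPolynomial.X (1 : Fin 2) : MvPolynomial (Fin 2) ℝ) • (Matrix.fromBlocks 1 0 0 0 : Matrix (Fin 2 ⊕ Fin s)
      (Fin 2 ⊕ Fin s) ℝ).map (MvPolynomial.C : ℝ →+* MvPolynomial (Fin 2) ℝ)).det) * (MvPolynomial.X 0 * MvPolynomial.pderiv 0 (∑ l, (MvPolynomial.X (0 : Fin 2) : MvPolynomial (Fin 2) ℝ) ^ d l •
      (S l).map (MvPolynomial.C : ℝ →+* MvPolynomial (Fin 2) ℝ) + (MvPolynomial.X (1 : Fin 2) : MvPolynomial (Fin 2) ℝ) • (Matrix.fromBlocks 1 0 0 0 : Matrix (Fin 2 ⊕ Fin s) (Fin 2 ⊕ Fin s) ℝ).map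
      (MvPolynomial.C : ℝ →+* MvPolynomial (Fin 2) ℝ)).det) ^ 2) = 0}.ncard ≤ 2 * (NN + NU) := by
  classical
  have hΦ := OsculationRankTwo.insertionPoly_two d S
  rw [hA, hM, hD] at hΦ
  rw [hΦ]
  set Φ : MvPolynomial (Fin 2) ℝ := (MvPolynomial.X 1 * MvPolynomial.X 1 * Polynomial.aeval (MvPolynomial.X 0 : MvPolynomial (Fin 2) ℝ) a
      + MvPolynomial.X 1 * Polynomial.aeval (MvPolynomial.X 0 : MvPolynomial (Fin 2) ℝ) m
      + Polynomial.aeval (MvPolynomial.X 0 : MvPolynomial (Fin 2) ℝ) δ) with hΦdef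
  set N : ℝ[X] := (a * Vp ^ 2 - m * Up * Vp + δ * Up ^ 2) with hNdef
  set osc := {p : Fin 2 → ℝ | 0 < p 0 ∧ 0 < p 1 ∧ MvPolynomial.eval p Φ = 0 ∧
      MvPolynomial.eval p
        (MvPolynomial.X 0 * MvPolynomial.pderiv 0 (MvPolynomial.X 0 * MvPolynomial.pderiv 0 Φ)
            * (MvPolynomial.X 1 * MvPolynomial.pderiv 1 Φ) ^ 2
          - 2 * (MvPolynomial.X 0 * MvPolynomial.pderiv 0 (MvPolynomial.X 1 * MvPolynomial.pderiv 1 Φ))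
            * (MvPolynomial.X 0 * MvPolynomial.pderiv 0 Φ) * (MvPolynomial.X 1 * MvPolynomial.pderiv 1 Φ)
          + MvPolynomial.X 1 * MvPolynomial.pderiv 1 (MvPolynomial.X 1 * MvPolynomial.pderiv 1 Φ)
            * (MvPolynomial.X 0 * MvPolynomial.pderiv 0 Φ) ^ 2) = 0} with hosc
  -- (1) from the set to real numbers: positivity, the curve equation, `U(t) b + V(t) = 0`, `N(t) = 0`
  have from_osc : ∀ p ∈ osc, 0 < p 0 ∧ 0 < p 1 ∧
      a.eval (p 0) * p 1 ^ 2 + m.eval (p 0) * p 1 + δ.eval (p 0) = 0 ∧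
      Up.eval (p 0) * p 1 + Vp.eval (p 0) = 0 ∧ N.eval (p 0) = 0 := by
    intro p hp
    obtain ⟨h0, h1, hΦ0, hH0⟩ := hp
    rw [hΦdef, FoldCurve.eval_Psi] at hΦ0
    rw [OsculationCuspGen.eval_logHessian_Psi a m δ Φ hΦdef p _ _ _ _ _ _ _ _ rfl rfl rfl rfl rfl rfl rfl rfl] at hH0
    have hl := OsculationCuspGen.osc_abscissa a m δ Up Vp (p 0) (p 1) _ _ _ _ _ _ _ _ _
      rfl rfl rfl rfl rfl rfl rfl rfl rfl hUp hVp hΦ0 hH0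
    have hn := OsculationCuspGen.resultant_step _ _ _ _ _ (p 1) hΦ0 hl
    refine ⟨h0, h1, hΦ0, hl, ?_⟩
    rw [hNdef]
    simp only [eval_sub, eval_add, eval_mul, eval_pow]
    linear_combination hn
  -- (2) a finite cover: abscissae in the roots of `N` or `U`, ordinates in the roots of the (nonzero) fibre quadratic
  set T : Finset ℝ := N.roots.toFinset ∪ Up.roots.toFinset with hT
  set F : Finset (Fin 2 → ℝ) := T.biUnion (fun t =>
    ((C (a.eval t) * X ^ 2 + C (m.eval t) * X + C (δ.eval t) : ℝ[X]).roots.toFinset).image (fun b => (![t, b] : Fin 2 → ℝ))) with hF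
  have hsub : osc ⊆ ↑F := by
    intro p hp
    obtain ⟨ht, hb, hΨ0, hl, hn⟩ := from_osc p hp
    rw [Finset.mem_coe, hF, Finset.mem_biUnion]
    refine ⟨p 0, ?_, ?_⟩
    · rw [hT, Finset.mem_union, Multiset.mem_toFinset, Multiset.mem_toFinset]
      by_cases hu : Up.eval (p 0) = 0
      · exact Or.inr ((mem_roots hU0).2 hu)
      · exact Or.inl ((mem_roots hN).2 hn)
    · rw [Finset.mem_image]
      have hq : (C (a.eval (p 0)) * X ^ 2 + C (m.eval (p 0)) * X + C (δ.eval (p 0)) : ℝ[X]) ≠ 0 :=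
        quadratic_ne_zero fun ⟨h1, h2, h3⟩ => hray (p 0) ht h1 h2 h3
      refine ⟨p 1, ?_, ?_⟩
      · rw [Multiset.mem_toFinset, mem_roots hq, IsRoot.def]
        simp only [eval_add, eval_mul, eval_pow, eval_C, eval_X]
        linear_combination hΨ0
      · funext i
        fin_cases i
        · rfl
        · rfl
  have hfin : osc.Finite := (Finset.finite_toSet F).subset hsub
  refine ⟨hfin, ?_⟩
  -- (3) the count
  have hTcard : T.card ≤ NN + NU := by
    rw [hT]
    refine (Finset.card_union_le _ _).trans (Nat.add_le_add ?_ ?_)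
    · exact (Multiset.toFinset_card_le _).trans ((card_roots' N).trans hNN)
    · exact (Multiset.toFinset_card_le _).trans ((card_roots' Up).trans hNU)
  calc osc.ncard ≤ (↑F : Set (Fin 2 → ℝ)).ncard := Set.ncard_le_ncard hsub (Finset.finite_toSet F)
    _ = F.card := Set.ncard_coe_finset F
    _ ≤ ∑ t ∈ T, (((C (a.eval t) * X ^ 2 + C (m.eval t) * X + C (δ.eval t) : ℝ[X]).roots.toFinset).image
          (fun b => (![t, b] : Fin 2 → ℝ))).card := Finset.card_biUnion_le
    _ ≤ ∑ _t ∈ T, 2 := by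
        refine Finset.sum_le_sum fun t _ => ?_
        refine Finset.card_image_le.trans ((Multiset.toFinset_card_le _).trans ?_)
        exact (card_roots' _).trans natDegree_quadratic_le
    _ = T.card * 2 := by rw [Finset.sum_const, smul_eq_mul]
    _ ≤ (NN + NU) * 2 := Nat.mul_le_mul_right _ hTcard
    _ = 2 * (NN + NU) := Nat.mul_comm _ _

-- same statement size.
set_option maxHeartbeats 1600000 in
/-- **Rank-two LOWER certificate, every splitting `(2, s)`.**  With `a, m, δ, U, V, N` as in `osc_rankTwo_finite_card_le`: a list `W` of pairwise
separated windows `(l, u)`, `0 < l ≤ u`, with `N(l)·N(u) ≤ 0` and, on `[l, u]`, `U·V < 0` and `a ≠ 0`, exhibits `W.length` distinct osculation points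
(the line's `osculationSet d S`, unfolded verbatim; assumed finite, e.g. by `osc_rankTwo_finite_card_le`). [folklore] -/
theorem osc_rankTwo_card_ge {s K : ℕ} (d : Fin K → ℕ) (S : Fin K → Matrix (Fin 2 ⊕ Fin s) (Fin 2 ⊕ Fin s) ℝ)
    (a m δ Up Vp : ℝ[X])
    (hA : (∑ l, (X : ℝ[X]) ^ d l • ((S l).toBlocks₂₂).map Polynomial.C).det = a)
    (hM : ((∑ l, (X : ℝ[X]) ^ d l • (S l).map Polynomial.C).updateRow (Sum.inl 0) (Pi.single (Sum.inl 0) 1 : Fin 2 ⊕ Fin s → ℝ[X])).det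
        + ((∑ l, (X : ℝ[X]) ^ d l • (S l).map Polynomial.C).updateRow (Sum.inl 1) (Pi.single (Sum.inl 1) 1 : Fin 2 ⊕ Fin s → ℝ[X])).det = m)
    (hD : (∑ l, (X : ℝ[X]) ^ d l • (S l).map Polynomial.C).det = δ)
    (hUp : Up = (4 : ℝ[X]) * a ^ 4 * m * δ * (X * derivative (X * derivative δ)) - (3 : ℝ[X]) * a ^ 4 * m * (X * derivative δ) ^ 2 + (4 : ℝ[X]) * a ^ 4 * δ ^ 2 * (X * derivative (X * derivative m)) - (4 : ℝ[X]) * a ^ 4 * δ * (X * derivative m) * (X * derivative δ) - a ^ 3 * m ^ 3 * (X * derivative (X * derivative δ)) - (5 : ℝ[X]) * a ^ 3 * m ^ 2 * δ * (X * derivative (X * derivative m)) + (4 : ℝ[X]) * a ^ 3 * m ^ 2 * (X * derivative m) * (X * derivative δ) - (8 : ℝ[X]) * a ^ 3 * m * δ ^ 2 * (X * derivative (X * derivative a)) + (2 : ℝ[X]) * a ^ 3 * m * δ * (X * derivative a) * (X * derivative δ) + a ^ 3 * m * δ * (X * derivative m) ^ 2 - (4 : ℝ[X]) * a ^ 3 *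 δ ^ 2 * (X * derivative a) * (X * derivative m) + a ^ 2 * m ^ 4 * (X * derivative (X * derivative m)) + (6 : ℝ[X]) * a ^ 2 * m ^ 3 * δ * (X * derivative (X * derivative a)) - (2 : ℝ[X]) * a ^ 2 * m ^ 3 * (X * derivative a) * (X * derivative δ) - a ^ 2 * m ^ 3 * (X * derivative m) ^ 2 + (4 : ℝ[X]) * a ^ 2 * m ^ 2 * δ * (X * derivative a) * (X * derivative m) + (9 : ℝ[X]) * a ^ 2 * m * δ ^ 2 * (X * derivative a) ^ 2 - a * m ^ 5 * (X * derivative (X * derivative a)) - (7 : ℝ[X]) * a * m ^ 3 * δ * (X * derivative a) ^ 2 + m ^ 5 * (X * derivative a) ^ 2)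
    (hVp : Vp = (4 : ℝ[X]) * a ^ 4 * δ ^ 2 * (X * derivative (X * derivative δ)) - (4 : ℝ[X]) * a ^ 4 * δ * (X * derivative δ) ^ 2 - a ^ 3 * m ^ 2 * δ * (X * derivative (X * derivative δ)) - (4 : ℝ[X]) * a ^ 3 * m * δ ^ 2 * (X * derivative (X * derivative m)) + (4 : ℝ[X]) * a ^ 3 * m * δ * (X * derivative m) * (X * derivative δ) - (4 : ℝ[X]) * a ^ 3 * δ ^ 3 * (X * derivative (X * derivative a)) + a ^ 2 * m ^ 3 * δ * (X * derivative (X * derivative m)) + (5 : ℝ[X]) * a ^ 2 * m ^ 2 * δ ^ 2 * (X * derivative (X * derivative a)) - (2 : ℝ[X]) * a ^ 2 * m ^ 2 * δ * (X * derivative a) * (X * derivative δ) - a ^ 2 * m ^ 2 * δ * (X * derivative m) ^ 2 + (4 : ℝ[X]) * a ^ 2 * m * δ ^ 2 * (X * derivative a) * (X * derivative m) + (4 : ℝ[X]) * a ^ 2 * δ ^ 3 * (X * derivative a) ^ 2 - a * m ^ 4 * δ * (X * derivative (X * derivative a)) - (6 : ℝ[X]) * a * m ^ 2 * δ ^ 2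 * (X * derivative a) ^ 2 + m ^ 4 * δ * (X * derivative a) ^ 2)
    (hfin : {p : Fin 2 → ℝ | 0 < p 0 ∧ 0 < p 1 ∧ MvPolynomial.eval p (∑ l, (MvPolynomial.X (0 : Fin 2) : MvPolynomial (Fin 2) ℝ) ^ d l • (S l).map (MvPolynomial.C : ℝ →+* MvPolynomial (Fin 2) ℝ) +
      (MvPolynomial.X (1 : Fin 2) : MvPolynomial (Fin 2) ℝ) • (Matrix.fromBlocks 1 0 0 0 : Matrix (Fin 2 ⊕ Fin s) (Fin 2 ⊕ Fin s) ℝ).map (MvPolynomial.C : ℝ →+* MvPolynomial (Fin 2) ℝ)).det = 0 ∧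
      MvPolynomial.eval p (MvPolynomial.X 0 * MvPolynomial.pderiv 0 (MvPolynomial.X 0 * MvPolynomial.pderiv 0 (∑ l, (MvPolynomial.X (0 : Fin 2) : MvPolynomial (Fin 2) ℝ) ^ d l • (S l).map
      (MvPolynomial.C : ℝ →+* MvPolynomial (Fin 2) ℝ) + (MvPolynomial.X (1 : Fin 2) : MvPolynomial (Fin 2) ℝ) • (Matrix.fromBlocks 1 0 0 0 : Matrix (Fin 2 ⊕ Fin s) (Fin 2 ⊕ Fin s) ℝ).map
      (MvPolynomial.C : ℝ →+* MvPolynomial (Fin 2) ℝ)).det) * (MvPolynomial.X 1 * MvPolynomial.pderiv 1 (∑ l, (MvPolynomial.X (0 : Fin 2) : MvPolynomial (Fin 2) ℝ) ^ d l • (S l).map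
      (MvPolynomial.C : ℝ →+* MvPolynomial (Fin 2) ℝ) + (MvPolynomial.X (1 : Fin 2) : MvPolynomial (Fin 2) ℝ) • (Matrix.fromBlocks 1 0 0 0 : Matrix (Fin 2 ⊕ Fin s) (Fin 2 ⊕ Fin s) ℝ).map
      (MvPolynomial.C : ℝ →+* MvPolynomial (Fin 2) ℝ)).det) ^ 2 - 2 * (MvPolynomial.X 0 * MvPolynomial.pderiv 0 (MvPolynomial.X 1 * MvPolynomial.pderiv 1 (∑ l, (MvPolynomial.X (0 : Fin 2) :
      MvPolynomial (Fin 2) ℝ) ^ d l • (S l).map (MvPolynomial.C : ℝ →+* MvPolynomial (Fin 2) ℝ) + (MvPolynomial.X (1 : Fin 2) : MvPolynomial (Fin 2) ℝ) • (Matrix.fromBlocks 1 0 0 0 : Matrix (Fin 2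
      ⊕ Fin s) (Fin 2 ⊕ Fin s) ℝ).map (MvPolynomial.C : ℝ →+* MvPolynomial (Fin 2) ℝ)).det)) * (MvPolynomial.X 0 * MvPolynomial.pderiv 0 (∑ l, (MvPolynomial.X (0 : Fin 2) : MvPolynomial (Fin 2) ℝ)
      ^ d l • (S l).map (MvPolynomial.C : ℝ →+* MvPolynomial (Fin 2) ℝ) + (MvPolynomial.X (1 : Fin 2) : MvPolynomial (Fin 2) ℝ) • (Matrix.fromBlocks 1 0 0 0 : Matrix (Fin 2 ⊕ Fin s) (Fin 2 ⊕ Fin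
      s) ℝ).map (MvPolynomial.C : ℝ →+* MvPolynomial (Fin 2) ℝ)).det) * (MvPolynomial.X 1 * MvPolynomial.pderiv 1 (∑ l, (MvPolynomial.X (0 : Fin 2) : MvPolynomial (Fin 2) ℝ) ^ d l • (S l).map
      (MvPolynomial.C : ℝ →+* MvPolynomial (Fin 2) ℝ) + (MvPolynomial.X (1 : Fin 2) : MvPolynomial (Fin 2) ℝ) • (Matrix.fromBlocks 1 0 0 0 : Matrix (Fin 2 ⊕ Fin s) (Fin 2 ⊕ Fin s) ℝ).map
      (MvPolynomial.C : ℝ →+* MvPolynomial (Fin 2) ℝ)).det) + MvPolynomial.X 1 * MvPolynomial.pderiv 1 (MvPolynomial.X 1 * MvPolynomial.pderiv 1 (∑ l, (MvPolynomial.X (0 : Fin 2) : MvPolynomial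
      (Fin 2) ℝ) ^ d l • (S l).map (MvPolynomial.C : ℝ →+* MvPolynomial (Fin 2) ℝ) + (MvPolynomial.X (1 : Fin 2) : MvPolynomial (Fin 2) ℝ) • (Matrix.fromBlocks 1 0 0 0 : Matrix (Fin 2 ⊕ Fin s)
      (Fin 2 ⊕ Fin s) ℝ).map (MvPolynomial.C : ℝ →+* MvPolynomial (Fin 2) ℝ)).det) * (MvPolynomial.X 0 * MvPolynomial.pderiv 0 (∑ l, (MvPolynomial.X (0 : Fin 2) : MvPolynomial (Fin 2) ℝ) ^ d l •
      (S l).map (MvPolynomial.C : ℝ →+* MvPolynomial (Fin 2) ℝ) + (MvPolynomial.X (1 : Fin 2) : MvPolynomial (Fin 2) ℝ) • (Matrix.fromBlocks 1 0 0 0 : Matrix (Fin 2 ⊕ Fin s) (Fin 2 ⊕ Fin s) ℝ).map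
      (MvPolynomial.C : ℝ →+* MvPolynomial (Fin 2) ℝ)).det) ^ 2) = 0}.Finite)
    (W : List (ℝ × ℝ)) (hsep : W.Pairwise (fun v w => v.2 < w.1))
    (hW : ∀ w ∈ W, 0 < w.1 ∧ w.1 ≤ w.2 ∧
      (∀ x, w.1 ≤ x → x ≤ w.2 → Up.eval x * Vp.eval x < 0 ∧ a.eval x ≠ 0) ∧
      (a * Vp ^ 2 - m * Up * Vp + δ * Up ^ 2).eval w.1 * (a * Vp ^ 2 - m * Up * Vp + δ * Up ^ 2).eval w.2 ≤ 0) :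
    W.length ≤ {p : Fin 2 → ℝ | 0 < p 0 ∧ 0 < p 1 ∧ MvPolynomial.eval p (∑ l, (MvPolynomial.X (0 : Fin 2) : MvPolynomial (Fin 2) ℝ) ^ d l • (S l).map (MvPolynomial.C : ℝ →+* MvPolynomial (Fin 2) ℝ) +
      (MvPolynomial.X (1 : Fin 2) : MvPolynomial (Fin 2) ℝ) • (Matrix.fromBlocks 1 0 0 0 : Matrix (Fin 2 ⊕ Fin s) (Fin 2 ⊕ Fin s) ℝ).map (MvPolynomial.C : ℝ →+* MvPolynomial (Fin 2) ℝ)).det = 0 ∧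
      MvPolynomial.eval p (MvPolynomial.X 0 * MvPolynomial.pderiv 0 (MvPolynomial.X 0 * MvPolynomial.pderiv 0 (∑ l, (MvPolynomial.X (0 : Fin 2) : MvPolynomial (Fin 2) ℝ) ^ d l • (S l).map
      (MvPolynomial.C : ℝ →+* MvPolynomial (Fin 2) ℝ) + (MvPolynomial.X (1 : Fin 2) : MvPolynomial (Fin 2) ℝ) • (Matrix.fromBlocks 1 0 0 0 : Matrix (Fin 2 ⊕ Fin s) (Fin 2 ⊕ Fin s) ℝ).map
      (MvPolynomial.C : ℝ →+* MvPolynomial (Fin 2) ℝ)).det) * (MvPolynomial.X 1 * MvPolynomial.pderiv 1 (∑ l, (MvPolynomial.X (0 : Fin 2) : MvPolynomial (Fin 2) ℝ) ^ d l • (S l).map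
      (MvPolynomial.C : ℝ →+* MvPolynomial (Fin 2) ℝ) + (MvPolynomial.X (1 : Fin 2) : MvPolynomial (Fin 2) ℝ) • (Matrix.fromBlocks 1 0 0 0 : Matrix (Fin 2 ⊕ Fin s) (Fin 2 ⊕ Fin s) ℝ).map
      (MvPolynomial.C : ℝ →+* MvPolynomial (Fin 2) ℝ)).det) ^ 2 - 2 * (MvPolynomial.X 0 * MvPolynomial.pderiv 0 (MvPolynomial.X 1 * MvPolynomial.pderiv 1 (∑ l, (MvPolynomial.X (0 : Fin 2) :
      MvPolynomial (Fin 2) ℝ) ^ d l • (S l).map (MvPolynomial.C : ℝ →+* MvPolynomial (Fin 2) ℝ) + (MvPolynomial.X (1 : Fin 2) : MvPolynomial (Fin 2) ℝ) • (Matrix.fromBlocks 1 0 0 0 : Matrix (Fin 2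
      ⊕ Fin s) (Fin 2 ⊕ Fin s) ℝ).map (MvPolynomial.C : ℝ →+* MvPolynomial (Fin 2) ℝ)).det)) * (MvPolynomial.X 0 * MvPolynomial.pderiv 0 (∑ l, (MvPolynomial.X (0 : Fin 2) : MvPolynomial (Fin 2) ℝ)
      ^ d l • (S l).map (MvPolynomial.C : ℝ →+* MvPolynomial (Fin 2) ℝ) + (MvPolynomial.X (1 : Fin 2) : MvPolynomial (Fin 2) ℝ) • (Matrix.fromBlocks 1 0 0 0 : Matrix (Fin 2 ⊕ Fin s) (Fin 2 ⊕ Fin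
      s) ℝ).map (MvPolynomial.C : ℝ →+* MvPolynomial (Fin 2) ℝ)).det) * (MvPolynomial.X 1 * MvPolynomial.pderiv 1 (∑ l, (MvPolynomial.X (0 : Fin 2) : MvPolynomial (Fin 2) ℝ) ^ d l • (S l).map
      (MvPolynomial.C : ℝ →+* MvPolynomial (Fin 2) ℝ) + (MvPolynomial.X (1 : Fin 2) : MvPolynomial (Fin 2) ℝ) • (Matrix.fromBlocks 1 0 0 0 : Matrix (Fin 2 ⊕ Fin s) (Fin 2 ⊕ Fin s) ℝ).map
      (MvPolynomial.C : ℝ →+* MvPolynomial (Fin 2) ℝ)).det) + MvPolynomial.X 1 * MvPolynomial.pderiv 1 (MvPolynomial.X 1 * MvPolynomial.pderiv 1 (∑ l, (MvPolynomial.X (0 : Fin 2) : MvPolynomial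
      (Fin 2) ℝ) ^ d l • (S l).map (MvPolynomial.C : ℝ →+* MvPolynomial (Fin 2) ℝ) + (MvPolynomial.X (1 : Fin 2) : MvPolynomial (Fin 2) ℝ) • (Matrix.fromBlocks 1 0 0 0 : Matrix (Fin 2 ⊕ Fin s)
      (Fin 2 ⊕ Fin s) ℝ).map (MvPolynomial.C : ℝ →+* MvPolynomial (Fin 2) ℝ)).det) * (MvPolynomial.X 0 * MvPolynomial.pderiv 0 (∑ l, (MvPolynomial.X (0 : Fin 2) : MvPolynomial (Fin 2) ℝ) ^ d l •
      (S l).map (MvPolynomial.C : ℝ →+* MvPolynomial (Fin 2) ℝ) + (MvPolynomial.X (1 : Fin 2) : MvPolynomial (Fin 2) ℝ) • (Matrix.fromBlocks 1 0 0 0 : Matrix (Fin 2 ⊕ Fin s) (Fin 2 ⊕ Fin s) ℝ).map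
      (MvPolynomial.C : ℝ →+* MvPolynomial (Fin 2) ℝ)).det) ^ 2) = 0}.ncard := by
  classical
  have hΦ := OsculationRankTwo.insertionPoly_two d S
  rw [hA, hM, hD] at hΦ
  rw [hΦ] at hfin ⊢
  set Φ : MvPolynomial (Fin 2) ℝ := (MvPolynomial.X 1 * MvPolynomial.X 1 * Polynomial.aeval (MvPolynomial.X 0 : MvPolynomial (Fin 2) ℝ) a
      + MvPolynomial.X 1 * Polynomial.aeval (MvPolynomial.X 0 : MvPolynomial (Fin 2) ℝ) m
      + Polynomial.aeval (MvPolynomial.X 0 : MvPolynomial (Fin 2) ℝ) δ) with hΦdef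
  set N : ℝ[X] := (a * Vp ^ 2 - m * Up * Vp + δ * Up ^ 2) with hNdef
  set osc := {p : Fin 2 → ℝ | 0 < p 0 ∧ 0 < p 1 ∧ MvPolynomial.eval p Φ = 0 ∧
      MvPolynomial.eval p
        (MvPolynomial.X 0 * MvPolynomial.pderiv 0 (MvPolynomial.X 0 * MvPolynomial.pderiv 0 Φ)
            * (MvPolynomial.X 1 * MvPolynomial.pderiv 1 Φ) ^ 2
          - 2 * (MvPolynomial.X 0 * MvPolynomial.pderiv 0 (MvPolynomial.X 1 * MvPolynomial.pderiv 1 Φ))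
            * (MvPolynomial.X 0 * MvPolynomial.pderiv 0 Φ) * (MvPolynomial.X 1 * MvPolynomial.pderiv 1 Φ)
          + MvPolynomial.X 1 * MvPolynomial.pderiv 1 (MvPolynomial.X 1 * MvPolynomial.pderiv 1 Φ)
            * (MvPolynomial.X 0 * MvPolynomial.pderiv 0 Φ) ^ 2) = 0} with hosc
  -- from real numbers to the set (over `{a ≠ 0}`)
  have mem_of : ∀ p : Fin 2 → ℝ, 0 < p 0 → 0 < p 1 → a.eval (p 0) ≠ 0 →
      a.eval (p 0) * p 1 ^ 2 + m.eval (p 0) * p 1 + δ.eval (p 0) = 0 →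
      Up.eval (p 0) * p 1 + Vp.eval (p 0) = 0 → p ∈ osc := by
    intro p h0 h1 hap hΨ0 hl
    refine ⟨h0, h1, ?_, ?_⟩
    · rw [hΦdef, FoldCurve.eval_Psi]; exact hΨ0
    · rw [OsculationCuspGen.eval_logHessian_Psi a m δ Φ hΦdef p _ _ _ _ _ _ _ _ rfl rfl rfl rfl rfl rfl rfl rfl]
      have hred := OsculationCuspGen.hess_reduce_poly a m δ Up Vp (p 0) (p 1) _ _ _ _ _ _ _ _ _
        rfl rfl rfl rfl rfl rfl rfl rfl rfl hUp hVp hΨ0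
      rw [hl] at hred
      exact (mul_eq_zero.1 hred).resolve_left (pow_ne_zero 4 hap)
  -- index the windows
  set k := W.length with hk
  set l : Fin k → ℝ := fun i => (W.get i).1 with hl
  set u : Fin k → ℝ := fun i => (W.get i).2 with hu
  have hWi : ∀ i : Fin k, 0 < l i ∧ l i ≤ u i ∧
      (∀ x, l i ≤ x → x ≤ u i → Up.eval x * Vp.eval x < 0 ∧ a.eval x ≠ 0) ∧
      N.eval (l i) * N.eval (u i) ≤ 0 := fun i => by
    simpa [hl, hu, hNdef] using hW (W.get i) (List.get_mem W i)
  have hsep' : ∀ i j : Fin k, i < j → u i < l j := by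
    intro i j hij
    have := List.pairwise_iff_get.1 hsep i j hij
    simpa [hl, hu] using this
  -- one zero of `N` per window
  have hroot : ∀ i, ∃ t, l i ≤ t ∧ t ≤ u i ∧ N.eval t = 0 := fun i =>
    exists_root_of_mul_nonpos N (hWi i).2.1 (hWi i).2.2.2
  choose t ht using hroot
  -- the exhibited points `(tᵢ, −V(tᵢ)/U(tᵢ))`
  set pt : Fin k → (Fin 2 → ℝ) := fun i => ![t i, -Vp.eval (t i) / Up.eval (t i)] with hpt
  have hmem : ∀ i, pt i ∈ osc := by
    intro i
    obtain ⟨htl, htu, hNt⟩ := ht i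
    obtain ⟨hs, ha0⟩ := (hWi i).2.2.1 (t i) htl htu
    have hU : Up.eval (t i) ≠ 0 := fun h => by rw [h, zero_mul] at hs; exact lt_irrefl _ hs
    have ht0 : 0 < t i := lt_of_lt_of_le (hWi i).1 htl
    have hb : 0 < -Vp.eval (t i) / Up.eval (t i) := by
      have hU2 : 0 < Up.eval (t i) ^ 2 := by positivity
      have : -Vp.eval (t i) / Up.eval (t i) = -(Up.eval (t i) * Vp.eval (t i)) / Up.eval (t i) ^ 2 := by
        field_simp
      rw [this]
      exact div_pos (by linarith) hU2
    have hline : Up.eval (t i) * (-Vp.eval (t i) / Up.eval (t i)) + Vp.eval (t i) = 0 := by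
      field_simp
      ring
    have hcurve : a.eval (t i) * (-Vp.eval (t i) / Up.eval (t i)) ^ 2 + m.eval (t i) * (-Vp.eval (t i) / Up.eval (t i))
        + δ.eval (t i) = 0 := by
      have hN0 : a.eval (t i) * Vp.eval (t i) ^ 2 - m.eval (t i) * Up.eval (t i) * Vp.eval (t i)
          + δ.eval (t i) * Up.eval (t i) ^ 2 = 0 := by
        have := hNt
        rw [hNdef] at this
        simpa only [eval_sub, eval_add, eval_mul, eval_pow] using this
      field_simp
      linear_combination hN0
    refine mem_of (pt i) ?_ ?_ ?_ ?_ ?_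
    · simpa [hpt] using ht0
    · simpa [hpt] using hb
    · simpa [hpt] using ha0
    · simpa [hpt] using hcurve
    · simpa [hpt] using hline
  -- distinct abscissae
  have hinj : Function.Injective pt := by
    intro i j hij
    have h0 : t i = t j := by
      have := congr_fun hij 0
      simpa [hpt] using this
    by_contra hne
    rcases lt_or_gt_of_ne hne with h | h
    · have := hsep' i j h
      linarith [(ht i).2.1, (ht j).1]
    · have := hsep' j i h
      linarith [(ht j).2.1, (ht i).1]
  -- count
  have hsub : ↑(Finset.univ.image pt) ⊆ osc := by
    intro p hp
    rw [Finset.mem_coe, Finset.mem_image] at hp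
    obtain ⟨i, -, rfl⟩ := hp
    exact hmem i
  calc k = (Finset.univ.image pt).card := by rw [Finset.card_image_of_injective _ hinj, Finset.card_univ, Fintype.card_fin]
    _ = (↑(Finset.univ.image pt) : Set (Fin 2 → ℝ)).ncard := (Set.ncard_coe_finset _).symm
    _ ≤ osc.ncard := Set.ncard_le_ncard hsub hfin

end OsculationCensus

end Summit.ValiantsHypothesis.ValiantsHypothesis.Theorems.LacunarySymmetroidMatrixDescartes
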